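import Summits.AtomisticToContinuum.HydrodynamicLimit.Theorems.ImplosionDichotomyPolynomialCompressionLevel3IntegratedRateSizes
import Literature.Analysis.FunctionSpaces.TorusL4Interpolation
import Literature.Analysis.FluidPDE.CompressibleEulerEnergySizes

/-!
# Integrated bookkeeping for the level-3 rate (line `log-lipschitz-budget`, stub 4)

Helper file for the crux `ImplosionDichotomy.PolynomialCompression` (stmt-AtomisticToContinuum-12587), stub
`stub_logBudgetShadowing` (level-3 estimate), companion of `…Level3IntegratedRate`: the integrated facts on `𝕋³`.
Cauchy–Schwarz pairing by pairing turns the crude group `3 M N · l3Rem(…)` into the polynomial envelope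
(`level3Rate_crude_integral`, constants `10⁸ M³ (1 + 72 R)`); Nirenberg's `L⁴` interpolation
(`TorusL4Interpolation`, `CompressibleEulerEnergySizes`) bounds `∫ q⁴` by `S₁² M E₃` (`level3Rate_q4`); the
divergence theorem for the summed fluxes (`level3Rate_div_zero`).
-/

noncomputable section

namespace Summit.AtomisticToContinuum.HydrodynamicLimit.Theorems

open Set MeasureTheory
open Literature.MathematicalPhysics.KineticTheory Literature.Analysis.FunctionSpaces

/-- `√(a E) √(b M E') ≤ c M √E √E'` when `a b ≤ c²` and `M ≥ 1`. [folklore] -/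
private theorem l3ir_sqrt_pair {a b c M E E' : ℝ} (ha : 0 ≤ a) (_hb : 0 ≤ b) (hc : 0 ≤ c) (hM : 1 ≤ M)
    (hE : 0 ≤ E) (hE' : 0 ≤ E') (habc : a * b ≤ c ^ 2) :
    Real.sqrt (a * E) * Real.sqrt (b * M * E') ≤ c * M * Real.sqrt E * Real.sqrt E' := by
  have hM0 : 0 ≤ M := by linarith
  rw [← Real.sqrt_mul (by positivity),
    show c * M * Real.sqrt E * Real.sqrt E' = c * M * (Real.sqrt E * Real.sqrt E') by ring,
    ← Real.sqrt_mul hE,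
    show c * M * Real.sqrt (E * E') = Real.sqrt ((c * M) ^ 2 * (E * E')) by
      rw [Real.sqrt_mul (sq_nonneg (c * M)) (E * E'), Real.sqrt_sq (by positivity)]]
  apply Real.sqrt_le_sqrt
  have hMM : M ≤ M ^ 2 := by nlinarith
  have h1 : a * b * M ≤ c ^ 2 * M ^ 2 :=
    (mul_le_mul_of_nonneg_right habc hM0).trans (mul_le_mul_of_nonneg_left hMM (sq_nonneg c))
  nlinarith [mul_le_mul_of_nonneg_right h1 (mul_nonneg hE hE')]

/-- Cauchy–Schwarz on `𝕋³` for continuous real functions: `∫ f g ≤ √(∫ f²) √(∫ g²)`. [folklore] -/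
private theorem l3ir_integral_mul_le {f g : T3 → ℝ} (hf : Continuous f) (hg : Continuous g) :
    ∫ x, f x * g x ≤ Real.sqrt (∫ x, f x ^ 2) * Real.sqrt (∫ x, g x ^ 2) := by
  -- adapted from `abs_integral_mul_le` (…ShadowInterpolation)
  have h2 : ENNReal.ofReal (2 : ℝ) = 2 := by simp
  have hfm : MemLp (fun x => |f x|) (ENNReal.ofReal 2) volume := by
    rw [h2]
    exact (continuous_abs.comp hf).memLp_of_hasCompactSupport (HasCompactSupport.of_compactSpace _)
  have hgm : MemLp (fun x => |g x|) (ENNReal.ofReal 2) volume := by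
    rw [h2]
    exact (continuous_abs.comp hg).memLp_of_hasCompactSupport (HasCompactSupport.of_compactSpace _)
  have hH := integral_mul_le_Lp_mul_Lq_of_nonneg (μ := volume) Real.HolderConjugate.two_two
    (ae_of_all _ fun x => abs_nonneg (f x)) (ae_of_all _ fun x => abs_nonneg (g x)) hfm hgm
  simp only [Real.rpow_two, sq_abs] at hH
  rw [Real.sqrt_eq_rpow, Real.sqrt_eq_rpow]
  calc ∫ x, f x * g x ≤ |∫ x, f x * g x| := le_abs_self _
    _ ≤ ∫ x, |f x * g x| := abs_integral_le_integral_abs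
    _ = ∫ x, |f x| * |g x| := integral_congr_ae (ae_of_all _ fun x => abs_mul _ _)
    _ ≤ _ := hH

/-- `∫ N g ≤ √(c_N ∫ e) √(c_g ∫ e')` for continuous data with `N² ≤ c_N e`, `g² ≤ c_g e'` pointwise.
[folklore] -/
private theorem l3ir_pair_le {N g e e' : T3 → ℝ} {cN cg : ℝ} (hN : Continuous N) (hg : Continuous g)
    (he : Continuous e) (he' : Continuous e') (h1 : ∀ x, N x ^ 2 ≤ cN * e x)
    (h2 : ∀ x, g x ^ 2 ≤ cg * e' x) :
    ∫ x, N x * g x ≤ Real.sqrt (cN * ∫ x, e x) * Real.sqrt (cg * ∫ x, e' x) := by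
  refine (l3ir_integral_mul_le hN hg).trans (mul_le_mul (Real.sqrt_le_sqrt ?_) (Real.sqrt_le_sqrt ?_)
    (Real.sqrt_nonneg _) (Real.sqrt_nonneg _))
  · rw [← integral_const_mul]
    exact integral_mono (hN.pow 2).integrable_unitAddTorus
      (continuous_const.mul he).integrable_unitAddTorus h1
  · rw [← integral_const_mul]
    exact integral_mono (hg.pow 2).integrable_unitAddTorus
      (continuous_const.mul he').integrable_unitAddTorus h2

/-- The bookkeeping of the crude group: six pairings with their Cauchy–Schwarz bounds add up to the
polynomial envelope (`M ≥ 1`). [folklore] -/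
private theorem l3ir_arith {M R S₀ S₁ Zc a b c d J1 J2 J3 J4 J5 J6 : ℝ} (hM : 1 ≤ M) (hR : 0 ≤ R)
    (hS₀ : 0 ≤ S₀) (hS₁ : 0 ≤ S₁) (hZc : 0 ≤ Zc) (ha0 : 0 ≤ a) (hb0 : 0 ≤ b) (hc0 : 0 ≤ c) (hd0 : 0 ≤ d)
    (I1 : J1 ≤ 810 * M * d * a) (I2 : J2 ≤ 2430 * M * d * b) (I3 : J3 ≤ 7290 * M * d * c)
    (I4 : J4 ≤ 21870 * M * d * d) (I5 : J5 ≤ 621200 * M * d * (S₁ * d)) (I6 : J6 ≤ 115 * d) :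
    120 * M ^ 2 * (1 + 72 * R) * J1 + 120 * M ^ 2 * (1 + 72 * R) * J2 +
        (120 * M ^ 2 * (S₀ + S₁) + 120 * M ^ 2 * (1 + 18 * R) + 3 * Zc * M ^ 2) * J3 +
        (120 * M ^ 2 * (S₀ + S₁) + 3 * Zc * M ^ 2) * J4 + 120 * M ^ 2 * J5 +
        3 * Zc * M ^ 2 * (1 + 72 * R) * J6 ≤
      100000000 * M ^ 3 * (1 + 72 * R) *
        ((S₀ + S₁ + Zc) * (d * d) + (a + b + (1 + S₀ + S₁ + Zc) * c + Zc) * d) := by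
  have hM0 : 0 ≤ M := by linarith
  have c1 : 0 ≤ 120 * M ^ 2 * (1 + 72 * R) := by positivity
  have c3 : 0 ≤ 120 * M ^ 2 * (S₀ + S₁) + 120 * M ^ 2 * (1 + 18 * R) + 3 * Zc * M ^ 2 := by positivity
  have c4 : 0 ≤ 120 * M ^ 2 * (S₀ + S₁) + 3 * Zc * M ^ 2 := by positivity
  have c5 : 0 ≤ 120 * M ^ 2 := by positivity
  have c6 : 0 ≤ 3 * Zc * M ^ 2 * (1 + 72 * R) := by positivity
  have K1 := mul_le_mul_of_nonneg_left I1 c1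
  have K2 := mul_le_mul_of_nonneg_left I2 c1
  have K3 := mul_le_mul_of_nonneg_left I3 c3
  have K4 := mul_le_mul_of_nonneg_left I4 c4
  have K5 := mul_le_mul_of_nonneg_left I5 c5
  have K6 := mul_le_mul_of_nonneg_left I6 c6
  -- the polynomial inequality after factoring `M³ d`
  have hPQ : 120 * (1 + 72 * R) * (810 * a) + 120 * (1 + 72 * R) * (2430 * b) +
        (120 * (S₀ + S₁) + 120 * (1 + 18 * R) + 3 * Zc) * (7290 * c) +
        (120 * (S₀ + S₁) + 3 * Zc) * (21870 * d) +
        120 * (621200 * (S₁ * d)) + 3 * Zc * (1 + 72 * R) * 115 ≤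
      100000000 * (1 + 72 * R) * ((S₀ + S₁ + Zc) * d + (a + b + (1 + S₀ + S₁ + Zc) * c + Zc)) := by
    linarith [mul_nonneg hR ha0, mul_nonneg hR hb0, mul_nonneg hR hc0, mul_nonneg hR hd0,
      mul_nonneg hS₀ hc0, mul_nonneg hS₁ hc0, mul_nonneg hS₀ hd0, mul_nonneg hS₁ hd0,
      mul_nonneg hZc hR, mul_nonneg hZc hc0, mul_nonneg hZc hd0,
      mul_nonneg (mul_nonneg hR hS₀) hd0, mul_nonneg (mul_nonneg hR hS₁) hd0,
      mul_nonneg (mul_nonneg hR hZc) hd0, mul_nonneg (mul_nonneg hR hS₀) hc0,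
      mul_nonneg (mul_nonneg hR hS₁) hc0, mul_nonneg (mul_nonneg hR hZc) hc0]
  have hM23 : M ^ 2 * (3 * Zc * (1 + 72 * R) * 115 * d) ≤ M ^ 3 * (3 * Zc * (1 + 72 * R) * 115 * d) :=
    mul_le_mul_of_nonneg_right (pow_le_pow_right₀ hM (by norm_num)) (by positivity)
  have hfin := mul_le_mul_of_nonneg_left hPQ (by positivity : 0 ≤ M ^ 3 * d)
  linarith [hfin, hM23, K1, K2, K3, K4, K5, K6]

/-- **The crude group, integrated.** For continuous nonnegative `N, m₀, m₁, q, n, e₀, …, e₃` on `𝕋³` with the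
pointwise size comparisons `N² ≤ 13122 e₃`, `m₀² ≤ 50 M e₀`, `m₁² ≤ 450 M e₁`, `q² ≤ 4050 M e₂`,
`n² ≤ 36450 M e₃`, the sup bounds `m₀ ≤ S₀`, `m₁ ≤ S₁` and the `L⁴` bound `∫ q⁴ ≤ 29406402 M S₁² ∫ e₃`,
the integral of `3 M N · l3Rem M (Z M) (18R + q) (54R + n) m₀ m₁ q` is bounded by
`10⁸ M³ (1 + 72R) [(S₀ + S₁ + Z) E₃ + (√E₀ + √E₁ + (1 + S₀ + S₁ + Z) √E₂ + Z) √E₃]`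
(Cauchy–Schwarz pairing by pairing). [folklore] -/
theorem level3Rate_crude_integral :
    ∀ {N m0 m1 q n e0 e1 e2 e3 : T3 → ℝ} {M R S₀ S₁ Zc : ℝ},
    Continuous N → Continuous m0 → Continuous m1 → Continuous q → Continuous n → Continuous e0 →
    Continuous e1 → Continuous e2 → Continuous e3 → 1 ≤ M → 0 ≤ R → 0 ≤ S₀ → 0 ≤ S₁ → 0 ≤ Zc →
    (∀ x, 0 ≤ N x) → (∀ x, 0 ≤ q x) → (∀ x, 0 ≤ n x) →
    (∀ x, 0 ≤ e0 x) → (∀ x, 0 ≤ e1 x) → (∀ x, 0 ≤ e2 x) → (∀ x, 0 ≤ e3 x) →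
    (∀ x, m0 x ≤ S₀) → (∀ x, m1 x ≤ S₁) →
    (∀ x, N x ^ 2 ≤ 13122 * e3 x) → (∀ x, m0 x ^ 2 ≤ 50 * M * e0 x) →
    (∀ x, m1 x ^ 2 ≤ 450 * M * e1 x) → (∀ x, q x ^ 2 ≤ 4050 * M * e2 x) →
    (∀ x, n x ^ 2 ≤ 36450 * M * e3 x) →
    (∫ x, q x ^ 4 ≤ 29406402 * M * S₁ ^ 2 * ∫ x, e3 x) →
    Integrable (fun x => 3 * M * N x * l3Rem M (Zc * M) (18 * R + q x) (54 * R + n x) (m0 x) (m1 x) (q x)) volume ∧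
    ∫ x, 3 * M * N x * l3Rem M (Zc * M) (18 * R + q x) (54 * R + n x) (m0 x) (m1 x) (q x) ≤
      100000000 * M ^ 3 * (1 + 72 * R) *
        ((S₀ + S₁ + Zc) * (∫ x, e3 x) +
          (Real.sqrt (∫ x, e0 x) + Real.sqrt (∫ x, e1 x) + (1 + S₀ + S₁ + Zc) * Real.sqrt (∫ x, e2 x) +
            Zc) * Real.sqrt (∫ x, e3 x)) := by
  intro N m0 m1 q n e0 e1 e2 e3 M R S₀ S₁ Zc hN hm0 hm1 hq hn he0 he1 he2 he3 hM hR hS₀ hS₁ hZc hN0 hq0 hn0 he00 he10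
    he20 he30 hmS0 hmS1 hNe hm0e hm1e hqe hne hq4
  have hM0 : 0 ≤ M := by linarith
  have hE0 : 0 ≤ ∫ x, e0 x := integral_nonneg he00
  have hE1 : 0 ≤ ∫ x, e1 x := integral_nonneg he10
  have hE2 : 0 ≤ ∫ x, e2 x := integral_nonneg he20
  have hE3 : 0 ≤ ∫ x, e3 x := integral_nonneg he30
  -- the six pairings
  have I1 : ∫ x, N x * m0 x ≤ 810 * M * Real.sqrt (∫ x, e3 x) * Real.sqrt (∫ x, e0 x) :=
    (l3ir_pair_le hN hm0 he3 he0 hNe hm0e).trans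
      (l3ir_sqrt_pair (by norm_num) (by norm_num) (by norm_num) hM hE3 hE0 (by norm_num))
  have I2 : ∫ x, N x * m1 x ≤ 2430 * M * Real.sqrt (∫ x, e3 x) * Real.sqrt (∫ x, e1 x) :=
    (l3ir_pair_le hN hm1 he3 he1 hNe hm1e).trans
      (l3ir_sqrt_pair (by norm_num) (by norm_num) (by norm_num) hM hE3 hE1 (by norm_num))
  have I3 : ∫ x, N x * q x ≤ 7290 * M * Real.sqrt (∫ x, e3 x) * Real.sqrt (∫ x, e2 x) :=
    (l3ir_pair_le hN hq he3 he2 hNe hqe).trans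
      (l3ir_sqrt_pair (by norm_num) (by norm_num) (by norm_num) hM hE3 hE2 (by norm_num))
  have I4 : ∫ x, N x * n x ≤ 21870 * M * Real.sqrt (∫ x, e3 x) * Real.sqrt (∫ x, e3 x) :=
    (l3ir_pair_le hN hn he3 he3 hNe hne).trans
      (l3ir_sqrt_pair (by norm_num) (by norm_num) (by norm_num) hM hE3 hE3 (by norm_num))
  have hN2 : ∫ x, N x ^ 2 ≤ 13122 * ∫ x, e3 x := by
    rw [← integral_const_mul]
    exact integral_mono (hN.pow 2).integrable_unitAddTorus (continuous_const.mul he3).integrable_unitAddTorus hNe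
  have I5 : ∫ x, N x * q x ^ 2 ≤ 621200 * M * Real.sqrt (∫ x, e3 x) * (S₁ * Real.sqrt (∫ x, e3 x)) := by
    have h1 : ∫ x, N x * q x ^ 2 ≤ Real.sqrt (13122 * ∫ x, e3 x) *
        Real.sqrt (29406402 * M * (S₁ ^ 2 * ∫ x, e3 x)) := by
      refine (l3ir_integral_mul_le hN (hq.pow 2)).trans (mul_le_mul (Real.sqrt_le_sqrt hN2)
        (Real.sqrt_le_sqrt ?_) (Real.sqrt_nonneg _) (Real.sqrt_nonneg _))
      calc ∫ x, (q x ^ 2) ^ 2 = ∫ x, q x ^ 4 := integral_congr_ae (ae_of_all _ fun x => by ring)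
        _ ≤ _ := hq4
        _ = _ := by ring
    have h2 := l3ir_sqrt_pair (a := 13122) (b := 29406402) (c := 621200) (by norm_num) (by norm_num)
      (by norm_num) hM hE3 (by positivity : 0 ≤ S₁ ^ 2 * ∫ x, e3 x) (by norm_num)
    rw [Real.sqrt_mul (sq_nonneg _), Real.sqrt_sq hS₁] at h2
    exact h1.trans h2
  have I6 : ∫ x, N x ≤ 115 * Real.sqrt (∫ x, e3 x) := by
    have h1 := l3ir_integral_mul_le hN (continuous_const (y := (1 : ℝ)))
    have hone : ∫ _x : T3, (1 : ℝ) ^ 2 = 1 := by simp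
    simp only [mul_one, hone, Real.sqrt_one] at h1
    refine h1.trans ((Real.sqrt_le_sqrt hN2).trans ?_)
    rw [Real.sqrt_mul (by norm_num)]
    have h3 : Real.sqrt 13122 ≤ 115 := by
      rw [Real.sqrt_le_left (by norm_num)]; norm_num
    exact mul_le_mul_of_nonneg_right h3 (Real.sqrt_nonneg _)
  -- the pointwise expansion of the crude term
  have hpt : ∀ x, 3 * M * N x * l3Rem M (Zc * M) (18 * R + q x) (54 * R + n x) (m0 x) (m1 x) (q x) ≤
      120 * M ^ 2 * (1 + 72 * R) * (N x * m0 x) + 120 * M ^ 2 * (1 + 72 * R) * (N x * m1 x) +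
        (120 * M ^ 2 * (S₀ + S₁) + 120 * M ^ 2 * (1 + 18 * R) + 3 * Zc * M ^ 2) * (N x * q x) +
        (120 * M ^ 2 * (S₀ + S₁) + 3 * Zc * M ^ 2) * (N x * n x) +
        120 * M ^ 2 * (N x * q x ^ 2) + 3 * Zc * M ^ 2 * (1 + 72 * R) * N x := by
    intro x
    unfold l3Rem
    have h1 : 120 * M ^ 2 * ((m0 x + m1 x) * (N x * (q x + n x))) ≤
        120 * M ^ 2 * ((S₀ + S₁) * (N x * (q x + n x))) :=
      mul_le_mul_of_nonneg_left (mul_le_mul_of_nonneg_right (add_le_add (hmS0 x) (hmS1 x))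
        (mul_nonneg (hN0 x) (add_nonneg (hq0 x) (hn0 x)))) (by positivity)
    nlinarith [h1]
  -- integrate (all functions are continuous)
  have ci : ∀ {f : T3 → ℝ}, Continuous f → Integrable f volume := fun hf => hf.integrable_unitAddTorus
  have J1 : Integrable (fun x => 120 * M ^ 2 * (1 + 72 * R) * (N x * m0 x)) volume := ci (by fun_prop)
  have J2 : Integrable (fun x => 120 * M ^ 2 * (1 + 72 * R) * (N x * m1 x)) volume := ci (by fun_prop)
  have J3 : Integrable (fun x =>
      (120 * M ^ 2 * (S₀ + S₁) + 120 * M ^ 2 * (1 + 18 * R) + 3 * Zc * M ^ 2) * (N x * q x)) volume :=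
    ci (by fun_prop)
  have J4 : Integrable (fun x => (120 * M ^ 2 * (S₀ + S₁) + 3 * Zc * M ^ 2) * (N x * n x)) volume :=
    ci (by fun_prop)
  have J5 : Integrable (fun x => 120 * M ^ 2 * (N x * q x ^ 2)) volume := ci (by fun_prop)
  have J6 : Integrable (fun x => 3 * Zc * M ^ 2 * (1 + 72 * R) * N x) volume := ci (by fun_prop)
  have hL : Integrable (fun x => 3 * M * N x *
      l3Rem M (Zc * M) (18 * R + q x) (54 * R + n x) (m0 x) (m1 x) (q x)) volume := by
    refine ci ?_
    unfold l3Rem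
    fun_prop
  have hstep := integral_mono hL (((((J1.add J2).add J3).add J4).add J5).add J6) hpt
  rw [integral_add' ((((J1.add J2).add J3).add J4).add J5) J6, integral_add' (((J1.add J2).add J3).add J4) J5,
    integral_add' ((J1.add J2).add J3) J4, integral_add' (J1.add J2) J3, integral_add' J1 J2] at hstep
  simp only [integral_const_mul] at hstep
  -- collect
  have hdd : Real.sqrt (∫ x, e3 x) * Real.sqrt (∫ x, e3 x) = ∫ x, e3 x := Real.mul_self_sqrt hE3
  refine ⟨hL, hstep.trans ((l3ir_arith hM hR hS₀ hS₁ hZc (Real.sqrt_nonneg _) (Real.sqrt_nonneg _)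
    (Real.sqrt_nonneg _) (Real.sqrt_nonneg _) I1 I2 I3 I4 I5 I6).trans_eq ?_)⟩
  rw [hdd]

/-- Power means: `(x + y + z)⁴ ≤ 27 (x⁴ + y⁴ + z⁴)`. [folklore] -/
private theorem l3ir_pow4_three (x y z : ℝ) : (x + y + z) ^ 4 ≤ 27 * (x ^ 4 + y ^ 4 + z ^ 4) := by
  have s1 : (x + y + z) ^ 2 ≤ 3 * (x ^ 2 + y ^ 2 + z ^ 2) := by
    nlinarith [sq_nonneg (x - y), sq_nonneg (y - z), sq_nonneg (x - z)]
  have s2 : (x ^ 2 + y ^ 2 + z ^ 2) ^ 2 ≤ 3 * (x ^ 4 + y ^ 4 + z ^ 4) := by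
    nlinarith [sq_nonneg (x ^ 2 - y ^ 2), sq_nonneg (y ^ 2 - z ^ 2), sq_nonneg (x ^ 2 - z ^ 2)]
  calc (x + y + z) ^ 4 = ((x + y + z) ^ 2) ^ 2 := by ring
    _ ≤ (3 * (x ^ 2 + y ^ 2 + z ^ 2)) ^ 2 := pow_le_pow_left₀ (sq_nonneg _) s1 2
    _ ≤ _ := by nlinarith [s2]

/-- `(a + b + Σ_c u_c)⁴ ≤ 27 (a⁴ + b⁴ + 27 Σ_c u_c⁴)` over `Fin 3`. [folklore] -/
private theorem l3ir_pow4 (a b : ℝ) (c : Fin 3 → ℝ) :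
    (a + b + ∑ i, c i) ^ 4 ≤ 27 * (a ^ 4 + b ^ 4 + 27 * ∑ i, c i ^ 4) := by
  have h1 : (∑ i, c i) ^ 4 ≤ 27 * ∑ i, c i ^ 4 := by
    simp only [Fin.sum_univ_three]
    exact l3ir_pow4_three _ _ _
  linarith [l3ir_pow4_three a b (∑ i, c i)]

/-- `hsq₃ φ = ∫ Σᵢⱼₖ (∂ₖ∂ⱼ∂ᵢφ)² ≤ ∫ g` when the pointwise bound holds. [folklore] -/
private theorem l3ir_hsq3_le {φ : T3 → ℝ} (hφ : Torus.IsSmooth φ) {g : T3 → ℝ} (hg : Continuous g)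
    (h : ∀ x, ∑ i, ∑ j, ∑ k, Torus.partialDeriv k (Torus.partialDeriv j (Torus.partialDeriv i φ)) x ^ 2 ≤ g x) :
    Literature.Analysis.FluidPDE.CompressibleEuler.hsq₃ φ ≤ ∫ x, g x := by
  have I0 : ∀ i j k, Integrable
      (fun x => Torus.partialDeriv k (Torus.partialDeriv j (Torus.partialDeriv i φ)) x ^ 2) volume :=
    fun i j k => ((((hφ.partialDeriv i).partialDeriv j).partialDeriv k).continuous.pow 2).integrable_unitAddTorus
  have I1 : ∀ i j, Integrable
      (fun x => ∑ k, Torus.partialDeriv k (Torus.partialDeriv j (Torus.partialDeriv i φ)) x ^ 2) volume :=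
    fun i j => integrable_finsetSum _ fun k _ => I0 i j k
  have I2 : ∀ i, Integrable
      (fun x => ∑ j, ∑ k, Torus.partialDeriv k (Torus.partialDeriv j (Torus.partialDeriv i φ)) x ^ 2) volume :=
    fun i => integrable_finsetSum _ fun j _ => I1 i j
  unfold Literature.Analysis.FluidPDE.CompressibleEuler.hsq₃
  calc ∑ i, ∑ j, ∑ k, ∫ x, Torus.partialDeriv k (Torus.partialDeriv j (Torus.partialDeriv i φ)) x ^ 2
      = ∑ i, ∑ j, ∫ x, ∑ k, Torus.partialDeriv k (Torus.partialDeriv j (Torus.partialDeriv i φ)) x ^ 2 :=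
        Finset.sum_congr rfl fun i _ => Finset.sum_congr rfl fun j _ => (integral_finsetSum _ fun k _ => I0 i j k).symm
    _ = ∑ i, ∫ x, ∑ j, ∑ k, Torus.partialDeriv k (Torus.partialDeriv j (Torus.partialDeriv i φ)) x ^ 2 :=
        Finset.sum_congr rfl fun i _ => (integral_finsetSum _ fun j _ => I1 i j).symm
    _ = ∫ x, ∑ i, ∑ j, ∑ k, Torus.partialDeriv k (Torus.partialDeriv j (Torus.partialDeriv i φ)) x ^ 2 :=
        (integral_finsetSum _ fun i _ => I2 i).symm
    _ ≤ ∫ x, g x := integral_mono (integrable_finsetSum _ fun i _ => I2 i) hg.integrable_unitAddTorus h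

/-- Continuity of the derivative sizes of a smooth function. [folklore] -/
theorem level3Rate_cont_dsize {φ : T3 → ℝ} (hφ : Torus.IsSmooth φ) :
    Continuous (fun x => Torus.dsize₁ φ x) ∧ Continuous (fun x => Torus.dsize₂ φ x) ∧
    Continuous (fun x => Torus.dsize₃ φ x) := by
  refine ⟨?_, ?_, ?_⟩
  · unfold Torus.dsize₁
    exact continuous_finsetSum _ fun i _ => (hφ.partialDeriv i).continuous.abs
  · unfold Torus.dsize₂
    exact continuous_finsetSum _ fun i _ => continuous_finsetSum _ fun j _ =>
      ((hφ.partialDeriv i).partialDeriv j).continuous.abs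
  · unfold Torus.dsize₃
    exact continuous_finsetSum _ fun i _ => continuous_finsetSum _ fun j _ => continuous_finsetSum _ fun k _ =>
      (((hφ.partialDeriv i).partialDeriv j).partialDeriv k).continuous.abs

/-- **The `L⁴` bound** `∫ q⁴ ≤ 29406402 M S₁² E₃` of the total second-derivative size `q = l3q` from the sup bound
`m₁ ≤ S₁` of the first derivatives (Nirenberg's interpolation `integral_dsize₂_pow_four_le`, component by
component, and the comparison of the unweighted third-order energies with `2 M e₃`). [folklore] -/
theorem level3Rate_q4 {ζ : ℝ → ℝ} {ρ θ ρ₁ θ₁ : ℝ → T3 → ℝ} {u u₁ : ℝ → T3 → V3} {s Mv S₁ : ℝ} (hMv : 0 < Mv)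
    (hδρ : Torus.IsSmooth (fun y => ρ s y - ρ₁ s y)) (hδθ : Torus.IsSmooth (fun y => θ s y - θ₁ s y))
    (hδu : Torus.IsSmooth (fun y => u s y - u₁ s y)) (he3c : Continuous fun x => l3e3 ζ ρ θ ρ₁ θ₁ u u₁ s x)
    (hS : ∀ x, l3m1 ρ θ ρ₁ θ₁ u u₁ s x ≤ S₁)
    (hw : ∀ x, Mv⁻¹ ≤ shadowWeightA ζ ρ θ s x ∧ Mv⁻¹ ≤ ρ s x ∧ Mv⁻¹ ≤ shadowWeightB ρ θ s x) :
    ∫ x, l3q ρ θ ρ₁ θ₁ u u₁ s x ^ 4 ≤ 29406402 * Mv * S₁ ^ 2 * ∫ x, l3e3 ζ ρ θ ρ₁ θ₁ u u₁ s x := by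
  have hδuc : ∀ c, Torus.IsSmooth (fun y => u s y c - u₁ s y c) := fun c => by
    have e : (fun y => u s y c - u₁ s y c) = fun y => (u s y - u₁ s y) c := by
      funext y; rw [PiLp.sub_apply]
    rw [e]; exact hδu.apply c
  -- sup bounds of the first derivatives of the components
  have hsum0 : ∀ x, 0 ≤ ∑ c : Fin 3, Torus.dsize₁ (fun y => u s y c - u₁ s y c) x :=
    fun x => Finset.sum_nonneg fun c _ => Torus.dsize₁_nonneg _ _
  have h1ρ : ∀ x i, |Torus.partialDeriv i (fun y => ρ s y - ρ₁ s y) x| ≤ S₁ := fun x i => by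
    refine (Torus.abs_partialDeriv_le_dsize₁ _ x i).trans (le_trans ?_ (hS x))
    unfold l3m1; linarith [Torus.dsize₁_nonneg (fun y => θ s y - θ₁ s y) x, hsum0 x]
  have h1θ : ∀ x i, |Torus.partialDeriv i (fun y => θ s y - θ₁ s y) x| ≤ S₁ := fun x i => by
    refine (Torus.abs_partialDeriv_le_dsize₁ _ x i).trans (le_trans ?_ (hS x))
    unfold l3m1; linarith [Torus.dsize₁_nonneg (fun y => ρ s y - ρ₁ s y) x, hsum0 x]
  have h1u : ∀ c x i, |Torus.partialDeriv i (fun y => u s y c - u₁ s y c) x| ≤ S₁ := fun c x i => by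
    refine (Torus.abs_partialDeriv_le_dsize₁ _ x i).trans (le_trans ?_ (hS x))
    have hc : Torus.dsize₁ (fun y => u s y c - u₁ s y c) x ≤ ∑ c : Fin 3, Torus.dsize₁ (fun y => u s y c - u₁ s y c) x :=
      Finset.single_le_sum (f := fun c => Torus.dsize₁ (fun y => u s y c - u₁ s y c) x)
        (fun c _ => Torus.dsize₁_nonneg _ _) (Finset.mem_univ c)
    unfold l3m1
    linarith [Torus.dsize₁_nonneg (fun y => ρ s y - ρ₁ s y) x, Torus.dsize₁_nonneg (fun y => θ s y - θ₁ s y) x]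
  -- third-order unweighted energies against `2 M E₃`
  have hP := fun x => level3Rate_sizes_pt (ζ := ζ) (ρ₁ := ρ₁) (θ₁ := θ₁) (x := x) hMv hδu (hw x).1 (hw x).2.1 (hw x).2.2
    rfl rfl rfl
  have hg : Continuous fun x => 2 * Mv * l3e3 ζ ρ θ ρ₁ θ₁ u u₁ s x := continuous_const.mul he3c
  have hE : ∫ x, 2 * Mv * l3e3 ζ ρ θ ρ₁ θ₁ u u₁ s x = 2 * Mv * ∫ x, l3e3 ζ ρ θ ρ₁ θ₁ u u₁ s x :=
    integral_const_mul _ _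
  have Hρ := l3ir_hsq3_le hδρ hg fun x => (hP x).2.2.2.2.2.2.1
  have Hθ := l3ir_hsq3_le hδθ hg fun x => (hP x).2.2.2.2.2.2.2.1
  have Hu := fun c => l3ir_hsq3_le (hδuc c) hg fun x => (hP x).2.2.2.2.2.2.2.2 c
  rw [hE] at Hρ Hθ Hu
  -- Nirenberg, component by component
  have h36 : (9 : ℝ) * (Fintype.card (Fin 3) : ℝ) ^ 6 = 6561 := by norm_num [Fintype.card_fin]
  have Lρ := Literature.Analysis.FluidPDE.CompressibleEuler.integral_dsize₂_pow_four_le hδρ (h1ρ)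
  have Lθ := Literature.Analysis.FluidPDE.CompressibleEuler.integral_dsize₂_pow_four_le hδθ (h1θ)
  have Lu := fun c => Literature.Analysis.FluidPDE.CompressibleEuler.integral_dsize₂_pow_four_le (hδuc c) (h1u c)
  rw [h36] at Lρ Lθ Lu
  -- pointwise power mean and integration
  have hpm : ∀ x, l3q ρ θ ρ₁ θ₁ u u₁ s x ^ 4 ≤ 27 * (Torus.dsize₂ (fun y => ρ s y - ρ₁ s y) x ^ 4 +
      Torus.dsize₂ (fun y => θ s y - θ₁ s y) x ^ 4 + 27 * ∑ c, Torus.dsize₂ (fun y => u s y c - u₁ s y c) x ^ 4) :=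
    fun x => by unfold l3q; exact l3ir_pow4 _ _ _
  have c2ρ := (level3Rate_cont_dsize hδρ).2.1
  have c2θ := (level3Rate_cont_dsize hδθ).2.1
  have c2u := fun c => (level3Rate_cont_dsize (hδuc c)).2.1
  have hlc : Continuous fun x => l3q ρ θ ρ₁ θ₁ u u₁ s x := by
    show Continuous fun x => Torus.dsize₂ (fun y => ρ s y - ρ₁ s y) x + Torus.dsize₂ (fun y => θ s y - θ₁ s y) x +
      ∑ c, Torus.dsize₂ (fun y => u s y c - u₁ s y c) x
    exact (c2ρ.add c2θ).add (continuous_finsetSum _ fun c _ => c2u c)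
  have i1 : Integrable (fun x => Torus.dsize₂ (fun y => ρ s y - ρ₁ s y) x ^ 4) volume :=
    (c2ρ.pow 4).integrable_unitAddTorus
  have i2 : Integrable (fun x => Torus.dsize₂ (fun y => θ s y - θ₁ s y) x ^ 4) volume :=
    (c2θ.pow 4).integrable_unitAddTorus
  have i3c : ∀ c, Integrable (fun x => Torus.dsize₂ (fun y => u s y c - u₁ s y c) x ^ 4) volume :=
    fun c => ((c2u c).pow 4).integrable_unitAddTorus
  have i3 : Integrable (fun x => ∑ c, Torus.dsize₂ (fun y => u s y c - u₁ s y c) x ^ 4) volume :=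
    integrable_finsetSum _ fun c _ => i3c c
  have i3' : Integrable (fun x => 27 * ∑ c, Torus.dsize₂ (fun y => u s y c - u₁ s y c) x ^ 4) volume :=
    i3.const_mul 27
  have i12 : Integrable (fun x => Torus.dsize₂ (fun y => ρ s y - ρ₁ s y) x ^ 4 +
      Torus.dsize₂ (fun y => θ s y - θ₁ s y) x ^ 4) volume := i1.add i2
  have i123 : Integrable (fun x => Torus.dsize₂ (fun y => ρ s y - ρ₁ s y) x ^ 4 +
      Torus.dsize₂ (fun y => θ s y - θ₁ s y) x ^ 4 + 27 * ∑ c, Torus.dsize₂ (fun y => u s y c - u₁ s y c) x ^ 4)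
      volume := i12.add i3'
  have hE3 : 0 ≤ ∫ x, l3e3 ζ ρ θ ρ₁ θ₁ u u₁ s x := integral_nonneg fun x => (hP x).2.2.2.2.2.1.2.2.2
  have hS0 : 0 ≤ S₁ ^ 2 := sq_nonneg _
  calc ∫ x, l3q ρ θ ρ₁ θ₁ u u₁ s x ^ 4
      ≤ ∫ x, 27 * (Torus.dsize₂ (fun y => ρ s y - ρ₁ s y) x ^ 4 + Torus.dsize₂ (fun y => θ s y - θ₁ s y) x ^ 4 +
          27 * ∑ c, Torus.dsize₂ (fun y => u s y c - u₁ s y c) x ^ 4) :=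
        integral_mono (hlc.pow 4).integrable_unitAddTorus (i123.const_mul 27) hpm
    _ = 27 * ((∫ x, Torus.dsize₂ (fun y => ρ s y - ρ₁ s y) x ^ 4) + (∫ x, Torus.dsize₂ (fun y => θ s y - θ₁ s y) x ^ 4) +
          27 * ∑ c, ∫ x, Torus.dsize₂ (fun y => u s y c - u₁ s y c) x ^ 4) := by
        rw [integral_const_mul, integral_add i12 i3', integral_add i1 i2, integral_const_mul,
          integral_finsetSum _ fun c _ => i3c c]
    _ ≤ 27 * (6561 * S₁ ^ 2 * (2 * Mv * ∫ x, l3e3 ζ ρ θ ρ₁ θ₁ u u₁ s x) +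
          6561 * S₁ ^ 2 * (2 * Mv * ∫ x, l3e3 ζ ρ θ ρ₁ θ₁ u u₁ s x) +
          27 * ∑ _c : Fin 3, 6561 * S₁ ^ 2 * (2 * Mv * ∫ x, l3e3 ζ ρ θ ρ₁ θ₁ u u₁ s x)) := by
        have k1 := Lρ.trans (mul_le_mul_of_nonneg_left Hρ (by positivity))
        have k2 := Lθ.trans (mul_le_mul_of_nonneg_left Hθ (by positivity))
        have k3 : ∑ c, ∫ x, Torus.dsize₂ (fun y => u s y c - u₁ s y c) x ^ 4 ≤
            ∑ _c : Fin 3, 6561 * S₁ ^ 2 * (2 * Mv * ∫ x, l3e3 ζ ρ θ ρ₁ θ₁ u u₁ s x) :=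
          Finset.sum_le_sum fun c _ => (Lu c).trans (mul_le_mul_of_nonneg_left (Hu c) (by positivity))
        linarith
    _ = 29406402 * Mv * S₁ ^ 2 * ∫ x, l3e3 ζ ρ θ ρ₁ θ₁ u u₁ s x := by
        simp only [Finset.sum_const, Finset.card_univ, Fintype.card_fin, nsmul_eq_mul]
        push_cast
        ring

/-- Divergence theorem for the summed fluxes: `∫ Σ_{n,m,l} Σᵢ ∂ᵢ Φ = 0` for smooth `Φ`, and integrability. [folklore] -/
theorem level3Rate_div_zero {Φ : Fin 3 → Fin 3 → Fin 3 → Fin 3 → T3 → ℝ} (h : ∀ n m l i, Torus.IsSmooth (Φ n m l i)) :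
    Integrable (fun x => ∑ n, ∑ m, ∑ l, ∑ i, Torus.partialDeriv i (Φ n m l i) x) volume ∧
    ∫ x, ∑ n, ∑ m, ∑ l, ∑ i, Torus.partialDeriv i (Φ n m l i) x = 0 := by
  have I0 : ∀ n m l i, Integrable (fun x => Torus.partialDeriv i (Φ n m l i) x) volume :=
    fun n m l i => ((h n m l i).partialDeriv i).integrable
  have I1 : ∀ n m l, Integrable (fun x => ∑ i, Torus.partialDeriv i (Φ n m l i) x) volume :=
    fun n m l => integrable_finsetSum _ fun i _ => I0 n m l i
  have I2 : ∀ n m, Integrable (fun x => ∑ l, ∑ i, Torus.partialDeriv i (Φ n m l i) x) volume :=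
    fun n m => integrable_finsetSum _ fun l _ => I1 n m l
  have I3 : ∀ n, Integrable (fun x => ∑ m, ∑ l, ∑ i, Torus.partialDeriv i (Φ n m l i) x) volume :=
    fun n => integrable_finsetSum _ fun m _ => I2 n m
  refine ⟨integrable_finsetSum _ fun n _ => I3 n, ?_⟩
  rw [integral_finsetSum _ fun n _ => I3 n]
  refine Finset.sum_eq_zero fun n _ => ?_
  rw [integral_finsetSum _ fun m _ => I2 n m]
  refine Finset.sum_eq_zero fun m _ => ?_
  rw [integral_finsetSum _ fun l _ => I1 n m l]
  refine Finset.sum_eq_zero fun l _ => ?_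
  rw [integral_finsetSum _ fun i _ => I0 n m l i]
  exact Finset.sum_eq_zero fun i _ => Torus.integral_partialDeriv_eq_zero_holds (h n m l i) i

end Summit.AtomisticToContinuum.HydrodynamicLimit.Theorems

end
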